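import Mathlib
import HarnessLib
import HarnessLib.Audit
import Summits.NavierStokesRegularity.Statement
import Summits.NavierStokesRegularity.NavierStokesRegularity.Theorems.LerayQuarterDissipationAssembly
import Literature.Analysis.FluidPDE.TypeIAncientMild
import HarnessLib.Audit.Status.Attr

/-!
Route: CalmSliceGate

DORMANT since 2026-08-29T19:38:48Z (census g0: costume|duplicate of route-NavierStokesRegularity-LerayQuarterDissipation; reader census-reader-50-g0) — unstaffed, not closed; items shared with open routes are served there. `ledger route dormant <id> --off` reactivates.

# Route CalmSliceGate — One calm slice or perpetual flicker — a dynamical dichotomy for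
finite-dissipation Type-I profiles

D-0145 LINE (ideator ns-idea-3 g3, technique card «splitting / non-equivalent criterion search»;
bears_on rung N0 = Clay (A) through route LerayQuarterDissipation's proved assembly EQL →
RecordTimeTypeI → DissipativeZoom → FiniteDissipationLiouville → NavierStokesRegularity; NO summit
is proved by this line). It is an ALTERNATIVE DECOMPOSITION of the crux FiniteDissipationLiouville
(stmt-NavierStokesRegularity-22144, D-0019: separate route sharing decls) along a DYNAMICAL,
non-equivalent criterion never used on this ladder: the scale-invariant UNSTEADINESS 𝔘(t,x) =
‖√(−t)((−t)∂_t w − ½w − ½(x·∇)w)‖ = |∂_sU| of Pineau–Vicol. X = EQL ∧ OneCalmSlice ∧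
PerpetualFlickerLiouville: (K1, provable) a finite-dissipation Type-I ancient mild profile with ONE
slice that is δ(C,K)-calm on the similarity ball of radius R(C,K) is regular at the apex; (K2,
deciding) a profile EVERY slice of which flickers (𝔘 > δ somewhere in that ball) is regular at the
apex. Supports RecordTimeTypeI / DissipativeZoom are LQD's closed items restated verbatim.
Lean: `EnstrophyQuarterLaw ∧ OneCalmSlice ∧ PerpetualFlickerLiouville`

## Assembly
Pure logic on top of LQD's PROVED assembly (lerayQuarterDissipation_assembly_proof, item 22147):
given C, K and a profile w in 𝒟(C,K), take δ, R from OneCalmSlice; either some slice is (δ,R)-calm —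
then OneCalmSlice gives apex-boundedness — or every slice flickers — then PerpetualFlickerLiouville
does; this is exactly LQD.FiniteDissipationLiouville, and LQD's assembly maps (EQL, RecordTimeTypeI,
DissipativeZoom, FDL) to NavierStokesRegularity. The deciding theorem closes uses all five items.

Rationale: WHY THIS LINE. Every size criterion tried on N0 (L³, L⁶, scaled energy, blow-down, far field, mass:
the landed portrait fdl_singular_portrait, p589632) is a NORM of one slice; the wall Bradshaw–Tsai
OP 5.1 survives them all because a backward-DSS profile has O(1) size in every scale-invariant norm.
Calmness is not a size: it is the distance of one slice from Leray's STEADY profile system, and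
there the tree owns a Liouville theorem with no smallness — Tsai1998 Thm 1 (tsai_selfsimilar_holds,
profiles in L^q, 3<q<∞) — while 𝒟-slices are in L⁶ (memLp_six_slice, p-SliceLSix). K1 is proved by
KNSS compactness (KochNadirashviliSereginSverak2009 §4) + singularity persistence
(persistent_singularity_seq) after rescaling the calm slice to t = −1: the limit is an element of 𝒟
whose slice at −1 solves Leray's system exactly, hence vanishes (Tsai, q = 6), hence the limit
vanishes on (−1,0) (forward uniqueness of mild solutions) — contradicting persistence. This is the
compactness (Chae–Wolf-style) sibling of PineauVicol2026 Thm 1.9 (arXiv:2607.09619 p. 8: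
quantitative, local, needs the one-point envelope and a pressure bound), transplanted to LQD's
global class where neither envelope nor pressure hypothesis is needed; it strictly contains the
near-one DSS corner (ChaeWolf2017RemovingDSS Thm 1.3: an S-periodic profile with |∂²_sU| ≤ C₂ has
|∂_sU| ≤ C₂S). What no listed route does: use PV's unsteadiness functional POSITIVELY
(LocalPressureProfileDoor and QuarterLogPincer cite PV only as a barrier) and carve the wall by
dynamics rather than by size: the residue K2 is «perpetual flicker», a closed, scale-invariant,
slice-wise floor that survives hull limits and Birkhoff minimalisation (LQD 22507). SECOND AXIS
(LINE 2, rev 1, split of K2): symmetry is not a size either. ONE δ-almost-axisymmetric slice (about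
some axis through the apex, on the similarity ball) already forces regularity inside 𝒟 — by
compactness the limit has an EXACTLY axisymmetric slice at −1, forward uniqueness of mild solutions
propagates the symmetry to (−1,0) (no backward uniqueness), and the LOCAL axisymmetric Type-I
exclusion SereginSverak2009 Thm 3.1 (tree: AxisymmetricTypeIExclusion_holds) decides the apex; the
residue of K2 becomes «perpetually flickering AND totally asymmetric on every slice». Prior art uses
symmetry of ALL slices (KochNadirashviliSereginSverak2009 Thm 1.3, SereginSverak2009; LQD portrait
item 8) or almost-axisymmetric DATA with small swirl (Liu–Xu 2023, arXiv:2305.01046); one slice,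
δ-almost, any swirl, Type-I class is the delta.

RANKED CRUXES. #2 PerpetualFlickerLiouville (crux) — PERPETUAL FLICKER LIOUVILLE. For all C, K, δ >
0, R > 0: a Type-I ancient mild solution w (KNSS gauge, constant C) with the finite-dissipation law
∫|∇w(s)|² ≤ K/√(−s) for all s < 0, every slice t < 0 of which carries a point x with ‖x‖ < R√(−t)
where the unsteadiness 𝔘(t,x) exceeds δ, is bounded on some backward parabolic cylinder at the
origin. The deciding residue: the DSS wall minus its calm members. [difficulty: open-problem] (why
it might fail: a singular backward-DSS member of 𝒟 (Bradshaw–Tsai OP 5.1 open) flickers on every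
slice once K1 holds, so K2 contains the wall ∩ 𝒟; the flicker floor gives a definite inertial power
but no sign — no monotone functional is known.) [BradshawTsai2017CPDE, PineauVicol2026,
ChaeWolf2017RemovingDSS, KochNadirashviliSereginSverak2009]
SPLIT OF #2 (gen 1 = LINE 2): #2 ⇐ OneSymmetricSlice (stmt-24452, crux, provable L–XL:
contradiction; rescale the near-symmetric slice to −1; KNSS compactness + persistent_singularity_seq
+ law_of_seqLimit + compactness of O(3) ⇒ a singular 𝒟-member with an exactly axisymmetric slice;
forward symmetry by uniqueness of bounded Oseen-mild solutions + O(3)-covariance; conjugate by g and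
fire AxisymmetricTypeIExclusion_holds, whose L³(Q₁)/L^{3/2}(Q₁) hypotheses hold in 𝒟 via
memLp_six_slice + Calderón–Zygmund for the mild pressure) → AsymmetricFlickerLiouville (stmt-24453,
crux, the residue) → glue stmt-24454 (pure logic; 5-line proof in the planner folder
line2/Split.lean). KERNEL IDENTITY (critic idea-crit-3, 01:24Z, price P1): K2 ⟺ FDL modulo K1, and
likewise AsymmetricFlickerLiouville ⟺ FDL modulo K1 ∧ OneSymmetricSlice — the residues are FDL on
strata, not smaller statements; the value of the line is the AXES (every calm or near-axisymmetric
scenario, incl. small 3-D perturbations of the axisymmetric-with-swirl DSS candidates, is removed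
from the wall by theorems). HOW THE FLOORS ARE CONSUMED (P1): first lemmas stub_unsteadinessPower /
stub_asymmetryPower of the birth skeleton of 24453 — Type-I parabolic smoothing makes 𝔘 and the
angular Killing derivative √(−t)∂_θ|₀(w∘gR_θg⁻¹ − gR_θg⁻¹∘w) uniformly Lipschitz in similarity
units, so the one-point floors become definite L² powers ≥ c(C,δ,R)(−t)^{3/2} on B(0,2R√(−t)) on
EVERY slice, i.e. a definite unsteadiness (resp. asymmetry) power per unit s-time over the whole
ancient range; the functional they are to be played against is Pineau–Vicol's Gaussian energy
balance in similarity variables (the only candidate in print); honest status: no monotone functional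
is known (stub_powerLiouville is the wall piece).
#3 OneCalmSlice (crux) — ONE CALM SLICE. For all C, K there are δ > 0 and R > 0 such that every
Type-I ancient mild solution w (constant C) with the finite-dissipation law (constant K) that has
ONE slice t < 0 on which 𝔘(t,x) ≤ δ for all ‖x‖ < R√(−t) is bounded on some backward parabolic
cylinder at the origin. Proof plan: contradiction sequence, rescale the calm slice to t = −1 (class,
law and singularity are scale-invariant), KNSS compactness + persistent_singularity_seq +
law_of_seqLimit, limit slice at −1 is an L⁶ (memLp_six_slice) C² solution of Leray's profile system
(a = 1/2, ν = 1, mild pressure) ⇒ zero by tsai_selfsimilar_holds (q = 6) ⇒ limit zero on (−1,0) by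
forward uniqueness of mild solutions ⇒ not singular. [difficulty: L] (why it might fail: the limit
slice must be shown to be an IsLerayProfile pair with the MILD pressure and zero constant part (L⁶,
not L⁶ + const); forward uniqueness must be run in the KNSS mild class from a zero slice with only
the Type-I bound near t = 0.) [PineauVicol2026, Tsai1998, KochNadirashviliSereginSverak2009,
AlbrittonBarker2019ARMA, ChaeKangLee2009]
P2 INTERFACE CHECK (done 01:35Z): Literature.Analysis.FluidPDE.IsLerayProfile ν a U P is the
pointwise C² system with ANY C¹ pressure — no decay, gauge or normalisation condition on P — and
tsai_selfsimilar (proved, tsai_selfsimilar_holds) needs only MemLp U q, 3<q<∞: the calm limit slice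
U = w(−1,·) with the rescaled mild pressure qualifies once IsTypeIAncientMild supplies its classical
pressure; rev-0 risk (a) [L⁶ vs KNSS gauge] dissolves (memLp_six_slice gives MemLp U 6 outright),
risks (b) [classical/pressure packaging] and (c) [forward uniqueness from a slice] remain = stubs
stub_instantLerayLiouville / stub_forwardVanishing.
#4 EnstrophyQuarterLaw (crux) — EQL (shared verbatim with LerayQuarterDissipation /
StretchingWellBinding / QuarterLogPincer, stmt-NavierStokesRegularity-1574): every maximal classical
Leray–Hopf solution from a rapidly decaying datum has enstrophy at Leray's quarter rate ∫|curl
u(t)|² ≤ K/√(T−t). The route's declared residual (tribunal: summit-live residual, as for LQD/QLP).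
[difficulty: open-problem] (why it might fail: it is the Type-II half of the problem: a Type-II
blow-up (enstrophy faster than (T−t)^{-1/2}) refutes it; nothing beyond Leray's lower bound
(T−t)^{-1/4} on ‖∇u‖₂ is known.) [Leray1934, KochNadirashviliSereginSverak2009]
#9 RecordTimeTypeI (support) — LQD's record-time capacity lemma (stmt-NavierStokesRegularity-22145,
CLOSED·proved): enstrophy at the quarter rate forces velocity Type I. Restated verbatim so the
deciding theorem can call LQD's proved assembly. [difficulty: provable-now]
[KochNadirashviliSereginSverak2009]
#9 DissipativeZoom (support) — LQD's dissipative zoom (stmt-NavierStokesRegularity-22146,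
CLOSED·proved): at a singular point of a Type-I blow-up with the quarter law, the KNSS zoom yields a
Type-I ancient mild profile with the finite-dissipation law, singular at the apex. Restated
verbatim. [difficulty: provable-now] [KochNadirashviliSereginSverak2009, AlbrittonBarker2019ARMA]

TWO-LAYER PLAN. PerpetualFlickerLiouville ⇐ FlickerRecurrentReduction (a singular flickering member
has a singular, uniformly recurrent, flickering element in its hull: Birkhoff as in LQD 22507; the
floor 𝔘 ≥ δ is closed under hull limits) → RecurrentFlickerLiouville (the meet of this residue with
LQD 22508). OneCalmSlice ⇐ CalmLimit (compactness + persistence + rescaling) → InstantLerayLiouville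
(a 𝒟-member whose slice at −1 has 𝔘 ≡ 0 vanishes there: Tsai q = 6) → forward uniqueness.

KILL CRITERIA. A refutation of OneCalmSlice (a singular finite-dissipation profile with a calm slice
— it would itself be a near-steady counterexample next to the wall) closes the route
refuted:OneCalmSlice. A refutation of PerpetualFlickerLiouville is a singular Type-I ancient
profile, i.e. essentially a negative answer to KNSS (L′): route closed, and LQD/QLP with it. A
refutation of EQL (Type-II blow-up) kills this route together with LQD/QLP/StretchingWellBinding.
FDL (22144) or RecurrentDissipativeLiouville (22508) proved elsewhere moots K2 (superseded --by
LQD). LINE 2: a refutation of OneSymmetricSlice (a singular 𝒟-profile with a δ-almost-axisymmetric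
slice for every δ,R) retires the split only (K2 reverts to unsplit; CalmSliceGate stands); a
refutation of AsymmetricFlickerLiouville is a genuinely three-dimensional, perpetually unsteady
singular Type-I profile — it refutes K2 and FDL as well.

NOT DECOMPOSED YET. STATE 2026-08-28T03:00Z: both converters are THEOREMS — OneCalmSlice 24375
(p595719, ns-lqd-p2) and OneSymmetricSlice 24452 (p598902; stubs p596355/p596582, SS09 packaging) —
and the supports 24376/24377, the Assembly 24378 and the glue 24454 (p596166) are closed; the
route's open load-bearing set is exactly the residue AsymmetricFlickerLiouville 24453 (the FDL wall
on the flickering ∧ totally-asymmetric stratum) plus the shared residual EnstrophyQuarterLaw 1574;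
EQUIVALENCE (07:55Z): since 24375 and 24452 are theorems, every singular member of 𝒟(C,K) lies in
the flickering ∩ totally-asymmetric stratum, hence AsymmetricFlickerLiouville 24453 ⟺
FiniteDissipationLiouville 22144 (⟺ PerpetualFlickerLiouville 24374 by Theorems
…PerpetualFlickerLiouvilleLinks p611151; ⟺ the envelope-class Type-I ancient Liouville problem by
envelope_of_minimal p612818) — 24453/24374 must never be staffed separately from 22144 and close
with it via two-lemma Links files; no further decomposition of 24453 is planned by this seat (the
remaining one-slice converters — quiet cone sector, nearly planar/2.5D slice, quiet core ball,
near-Beltrami slice — are banked in the ideator HANDOFF as low-value re-cuts), and the recommended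
staffing is refutation-budget-first via the instrument rows memo
(pub/ideators/ns-idea-3/INSTRUMENT-ROWS-CalmSliceGate.md: 𝔘_min, 𝒜_min, C, K per candidate profile).
δ(C,K), R(C,K) of K1 and δ', R' of OneSymmetricSlice are compactness constants (no instrument can
test the residues' hypotheses numerically; the K2 falsifier does not need them). BOOKED (critic P3),
not filed this generation: the quantitative child of K1 — Pineau–Vicol's Gaussian energy method run
inside 𝒟 to make δ(C,K) explicit and the calm/flicker axis measurable (obstacle to type now: PV's
annular pressure bound, which 𝒟 supplies only as p ∈ L^{3/2}_loc uniformly in similarity units — to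
be checked against arXiv:2607.09619 (1.12)). Not split: the recurrence / DSS sub-cases of
AsymmetricFlickerLiouville (third layer forbidden; a new route if ever). No interface objects are
posited.

CHEAPEST FALSIFIER. For K1: check that an exactly steady slice forces triviality in 𝒟 — i.e. that a
C² pair (w(−1,·), p(−1,·)) with 𝔘 ≡ 0 satisfies Literature.Analysis.FluidPDE.IsLerayProfile 1 (1/2)
and MemLp _ 6 so that tsai_selfsimilar_holds fires; if IsLerayProfile demanded decay or a pressure
normalisation the mild pressure lacks, K1's plan breaks at that line. For K2: any converged
nontrivial backward λ-DSS profile from the pub-ns-dss instrument (N6c backward-DSS Newton search)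
refutes K2, FDL and (L′) at once; a converged profile with a calm slice would refute K1. For
OneSymmetricSlice: the one-file check that a g-conjugated 𝒟-member meets
AxisymmetricTypeIExclusion_holds' hypothesis list (IsDistributionalNSSolutionOn ssCylinderOpens 1 0
u p with the mild pressure, u ∈ L³(Q₁), p ∈ L^{3/2}(Q₁), IsAxisymmetric slices on Ioo (−1) 0, a.e.
√(−t)‖u‖ ≤ C); if the distributional packaging of IsTypeIAncientMild is missing in the tree, that is
the first support lemma (skeleton rev 2 on 24452 names the interface facts as stubs:
isometryPullback = O(3)-covariance of class and law, rotationPullback, forwardMildUniqueness =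
Kato-class forward uniqueness from one slice, axisymTypeIExclusionStd = SS09 about the standard axis
in 𝒟; the reduction to the standard axis and the forward propagation of symmetry are proved there).
Paper check for AsymmetricFlickerLiouville (critic P5): perturb the axisymmetric-with-swirl DSS
candidates of Hou 2022 (arXiv:2107.06509 lineage) / Guillod–Šverák 2023 non-axisymmetrically — if
their slices keep returning δ′-close to SOME axis through the apex, OneSymmetricSlice already
removes them and 24453's stratum is smaller than its wording suggests (good for the line; stated
here), while a candidate staying δ′-far from every axis on every slice AND converging would refute
24453. Instrument row: an axisymmetric-with-swirl backward-DSS candidate (pub-ns-dss) with a small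
non-axisymmetric perturbation is exactly the scenario OneSymmetricSlice removes; a converged
genuinely 3-D unsteady profile refutes AsymmetricFlickerLiouville. BC7: rev 0 3/3 CLEAN, rev 1
children 2/2 CLEAN; C→S probes fail.

NUMBERS. Type-I constant C ≥ 1 for a singular profile (one_le_typeI_const_of_singular); K > K₀
(stub_smallDissipationGap); Chae–Wolf threshold λ < c₁(w); PV's δ₀(Cu) and s₀(Cu,Cp)
(arXiv:2607.09619 Thm 1.9) are explicit but local.

DEFINITION REQUESTS. None: the unsteadiness functional is inlined (deriv in t, fderiv in x); a named
def Literature.Analysis.FluidPDE.similarityUnsteadiness may be requested by the prover of K1 for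
readability.

Novelty: Searches (2026-08-28): lit search --hybrid "regularity criterion one time slice nearly stationary
self-similar variables Type I ancient" (8 docs: [corpus:paper:arxiv-2607.09619 p.8] = PV Thm 1.9,
[corpus:book:seregin2014-lecture-notes-regularity-theory-navier-stokes-equations p.170] backward
uniqueness/Type I context, rest off-topic); lit vsearch "almost steady in similarity variables at a
single time ⇒ regular" (no NS hit beyond Seregin's notes p.131); lit galaxy search "asymptotically
self-similar|almost self-similar|nearly self-similar" --star all and "one time slice|single time
slice|quasi-steady blow" --star pdf: no hits (noise only) in galaxy; tree: rg over Theses/ for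
PineauVicol — cited only as a barrier (LocalPressureProfileDoor, QuarterLogPincer) and in
Literature/Barriers/NearOneDssTypeIExclusion; ledger negatives: no calm/flicker/unsteadiness
statement.
Nearest prior art found: PineauVicol2026 Thm 1.9 [corpus:paper:arxiv-2607.09619 p.8] (one δ₀-quiet
slice ⇒ regular; local, quantitative, under the one-point envelope + annular pressure bound);
ChaeKangLee2009 Thm 1.2 and Chae2007 Thm 1.5 (convergence-to-a-profile versions); in tree, LQD's
portrait leaves (p589632: size/symmetry criteria only) and split 22507/22508 (recurrence criterion).
Delta: the calm/flicker axis is a dynamical one-slice criterion, non-equivalent to every size or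
recurrence criterion on the ladder; K1 removes PV's envelope and pressure hypotheses inside 𝒟 by
compactness + Tsai's L⁶ Liouville, an  [refs: 2305.05272, paper:arxiv-2607.09619, book:seregin2014-lecture-notes-regularity-theory-navier-stokes-equations, paper:arxiv-2305.01046, PineauVicol2026, ChaeKangLee2009, Chae2007, KochNadirashviliSereginSverak2009, SereginSverak2009]

Barriers (technique_class: compactness-rigidity, self-similar-liouville, one-slice): - technique_class: compactness-rigidity, self-similar-liouville, one-slice
- Literature.Barriers.NavierStokesRegularity.NearOneDssTypeIExclusion: consistent and subsumed — a
near-one DSS member of 𝒟 is calm on every slice (|∂_sU| ≤ C₂·log λ), so K1 re-derives the Chae–Wolf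
corner; K2 sits AT the wall for λ away from 1: it does not evade Bradshaw–Tsai OP 5.1; the bet is
that a slice-wise flicker floor (a definite |∂_sU|, closed under hull limits) is the extra structure
a rigidity argument on minimal hull elements can use.
- Literature.Barriers.NavierStokesRegularity.AveragedTypeIBlowup: outside — K1's proof uses the
exact Leray profile system and Tsai's head-pressure maximum principle, which averaged nonlinearities
destroy; K2 must likewise use fine structure (priced); both statements quantify over mild (exact)
solutions, so the Scheffer / Navier–Stokes-inequality constructions do not bear on them.
- Literature.Barriers.NavierStokesRegularity.AxisymmetricTypeIExclusion: a positive fact, now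
LOAD-BEARING for LINE 2: OneSymmetricSlice (24452) is proved by firing
AxisymmetricTypeIExclusion_holds on the g-conjugate of the compactness limit after forward
propagation of the exact symmetry; AsymmetricFlickerLiouville (24453) is by construction outside its
scope (no symmetric slice) — it does not evade Bradshaw–Tsai OP 5.1; the bet is as for K2, with two
definite powers (unsteadiness, asymmetry) instead of one.
- Literature.Barriers.NavierStokesRegularity.CompactPerturbationRigidity:

History (route lifecycle, newest last):
- 2026-08-29T19:38:48Z · DORMANT — census g0: costume|duplicate of route-NavierStokesRegularity-LerayQuarterDissipation; reader census-reader-50-g0 (operator:999:1512759)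

sub-problem: NavierStokesRegularity · status: dormant · opened planner-ns-idea-3-g3-0 2026-08-28T01:21:00Z · rev 7 · ledger route-NavierStokesRegularity-CalmSliceGate
GENERATED by the gate from the ledger (D-0016/17). Provers cite these decls: `theorem foo : Summit.NavierStokesRegularity.NavierStokesRegularity.Theses.CalmSliceGate.<Decl> := …` in Summits/NavierStokesRegularity/NavierStokesRegularity/Theorems/<Name>.lean.
-/

namespace Summit.NavierStokesRegularity.NavierStokesRegularity.Theses.CalmSliceGate

open scoped BigOperators Topology Manifold Classical MeasureTheory ProbabilityTheory Matrix InnerProductSpace ComplexConjugate ContinuousMap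
open Filter Set Function TopologicalSpace MeasureTheory

attribute [summit_statement] _root_.NavierStokesRegularity

open Literature.NS

/-- item stmt-NavierStokesRegularity-24374 · crux · rank 2 · SPLIT (gen 1) into OneSymmetricSlice, AsymmetricFlickerLiouville + glue PerpetualFlickerLiouvilleGlue · direct attempts still welcome (low priority) · by planner
why it might fail: a singular backward-DSS member of D (Bradshaw-Tsai OP 5.1 open) flickers on every slice once K1 holds, so K2 contains the wall ∩ D; the flicker floor gives a definite inertial power but no sign — no monotone functional is known; K2 <-> FDL modulo K1 (critic kernel).
sources: BradshawTsai2017CPDE, PineauVicol2026, ChaeWolf2017RemovingDSS, KochNadirashviliSereginSverak2009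
[crux] PERPETUAL FLICKER LIOUVILLE. For all C, K, δ > 0, R > 0: a Type-I ancient mild solution w
(KNSS gauge, constant C) with the finite-dissipation law ∫|∇w(s)|² ≤ K/√(−s) for all s < 0, every
slice t < 0 of which carries a point x with ‖x‖ < R√(−t) where the unsteadiness 𝔘(t,x) exceeds δ, is
bounded on some backward parabolic cylinder at the origin. The deciding residue: the DSS wall minus
its calm members. [difficulty: open-problem] -/
@[route_item "route-NavierStokesRegularity-CalmSliceGate", crux]
def PerpetualFlickerLiouville : Prop :=
  ∀ (C K δ R : ℝ), 0 < δ → 0 < R → ∀ (w : ℝ → EuclideanSpace ℝ (Fin 3) → EuclideanSpace ℝ (Fin 3)), Literature.Analysis.FluidPDE.IsTypeIAncientMild C w → (∀ s : ℝ, s < 0 → ∫⁻ x, ‖fderiv ℝ (w s) x‖ₑ ^ 2 ≤ ENNReal.ofReal (K / Real.sqrt (-s))) → (∀ t < 0, ∃ x ∈ Metric.ball (0 : EuclideanSpace ℝ (Fin 3)) (R * Real.sqrt (-t)), δ < ‖Real.sqrt (-t) • ((-t) • deriv (fun τ => w τ x) t - (1 / 2 : ℝ) • w t x - (1 / 2 :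 ℝ) • fderiv ℝ (w t) x x)‖) → ¬ (∀ r > 0, ∀ M : ℝ, ∃ t ∈ Set.Ioo (-(r ^ 2)) (0 : ℝ), ∃ x ∈ Metric.ball (0 : EuclideanSpace ℝ (Fin 3)) r, M < ‖w t x‖)

-- parent: PerpetualFlickerLiouville · child (gen 1)
/--     item stmt-NavierStokesRegularity-24452 · crux · rank 201 · closed · proved by Summit.NavierStokesRegularity.NavierStokesRegularity.Theorems.oneSymmetricSlice_proof (prover)
    parent: PerpetualFlickerLiouville · by planner
    why it might fail: Interface risk only: needs O(3)-covariance + forward uniqueness of IsTypeIAncientMild from one slice, and the distributional/pressure packaging (u in L3(Q1), p=RR(w⊗w) in L3/2(Q1)) to fire AxisymmetricTypeIExclusion_holds.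
    sources: SereginSverak2009, KochNadirashviliSereginSverak2009, arXiv:2305.01046, Tsai1998
[crux, provable, L-XL] ONE SYMMETRIC SLICE (non-equivalent one-slice criterion #2, non-size,
scale-invariant): for every Type-I constant C and dissipation constant K there are delta(C,K)>0,
R(C,K)>0 such that a member w of the finite-dissipation class D(C,K) (IsTypeIAncientMild C + slice
law) having ONE slice t<0 that is delta-almost axisymmetric about SOME axis through the apex on the
similarity ball B(0,R sqrt(-t)) — sup_theta sup_x sqrt(-t)|w(t,g rotZ_theta g^-1 x) - g rotZ_theta
g^-1 w(t,x)| <= delta for some linear isometry g — is apex-regular. Proof plan (skeleton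
OneSymmetricSlice_birth): contradiction; rescale the slice to t=-1; KNSS compactness +
persistent_singularity_seq + law_of_seqLimit + compactness of O(3) give a singular member of D(C,K)
whose slice at -1 is EXACTLY axisymmetric about an axis g(e_2-axis) through 0; forward uniqueness of
bounded Oseen-mild solutions + O(3)-covariance propagate the symmetry to (-1,0); conjugating by g,
Seregin-Sverak 2009 Thm 3.1 (tree:
Literature.Barriers.NavierStokesRegularity.AxisymmetricTypeIExclusion_holds; its L3(Q)/L3/2(Q)
hypotheses hold in D by memLp_six_slice + Calderon-Zygmund for the mild pressure) makes the apex
regular — -/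
@[route_item "route-NavierStokesRegularity-CalmSliceGate"]
def OneSymmetricSlice : Prop :=
  ∀ (C K : ℝ), ∃ δ > 0, ∃ R > 0, ∀ (w : ℝ → EuclideanSpace ℝ (Fin 3) → EuclideanSpace ℝ (Fin 3)), Literature.Analysis.FluidPDE.IsTypeIAncientMild C w → (∀ s : ℝ, s < 0 → ∫⁻ x, ‖fderiv ℝ (w s) x‖ₑ ^ 2 ≤ ENNReal.ofReal (K / Real.sqrt (-s))) → (∃ t < 0, ∃ g : EuclideanSpace ℝ (Fin 3) ≃ₗᵢ[ℝ] EuclideanSpace ℝ (Fin 3), ∀ θ : ℝ, ∀ x ∈ Metric.ball (0 : EuclideanSpace ℝ (Fin 3)) (R * Real.sqrt (-t)), Real.sqrt (-t) * ‖w t (g (Literature.Analysis.FluidPDE.rotZ θ (g.symm x))) - g (Literature.Analysis.FluidPDE.rotZ θ (g.symm (w t x)))‖ ≤ δ) → ¬ (∀ r > 0, ∀ M : ℝ, ∃ t ∈ Set.Ioo (-(r ^ 2)) (0 : ℝ), ∃ x ∈ Metric.ball (0 : EuclideanSpace ℝ (Fin 3)) r, M < ‖w t x‖)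

-- `OneSymmetricSlice` holds: proved by `Summit.NavierStokesRegularity.NavierStokesRegularity.Theorems.oneSymmetricSlice_proof` (its module imports this route file, so no `_holds` link can be stated here).

-- parent: PerpetualFlickerLiouville · child (gen 1)
/--     item stmt-NavierStokesRegularity-24453 · crux · rank 202 · open
    parent: PerpetualFlickerLiouville · by planner
    why it might fail: It is FDL on the generic stratum: a genuinely 3-D, perpetually unsteady backward-DSS profile in D(C,K) refutes it, and no monotone functional consuming either floor is known (same wall as 22144/22508, strictly smaller residue).
    sources: ChaeWolf2017RemovingDSS, BradshawTsai2017CPDE, PineauVicol2026, SereginSverak2009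
[crux, deciding residue of the split] ASYMMETRIC FLICKER LIOUVILLE: a member of D(C,K) that flickers
perpetually (unsteadiness floor delta on every similarity ball B(0,R sqrt(-t)), as in the parent)
AND each of whose slices is delta'-far (sup over theta and over B(0,R' sqrt(-t))) from axisymmetry
about EVERY axis through the apex is apex-regular. This is PerpetualFlickerLiouville restricted to
the totally-asymmetric stratum: by the kernel identity K2 <-> FDL mod K1 (critic 01:24Z) it is FDL
on the stratum {flickering} ∩ {totally asymmetric}; the value is the second AXIS of the portrait —
every near-axisymmetric scenario (the numerically favoured axisymmetric-with-swirl DSS candidates of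
Hou 2022 / Guillod-Sverak 2023 type, and their small non-axisymmetric perturbations) is removed from
the wall by a theorem, so a surviving counterexample must be genuinely three-dimensional on every
slice. Cheapest falsifier: any converged nontrivial backward-DSS profile (pub-ns-dss instrument)
that is BOTH unsteady and far from axisymmetric at every phase; instrument row that would refute the
key lemma: pub-ns-dss 'non-axisymmetric DSS branch' (none converged to date). No summit is proved by
this l -/
@[route_item "route-NavierStokesRegularity-CalmSliceGate"]
def AsymmetricFlickerLiouville : Prop :=
  ∀ (C K δ R δ' R' : ℝ), 0 < δ → 0 < R → 0 < δ' → 0 < R' → ∀ (w : ℝ → EuclideanSpace ℝ (Fin 3) → EuclideanSpace ℝ (Fin 3)), Literature.Analysis.FluidPDE.IsTypeIAncientMild C w → (∀ s : ℝ, s < 0 → ∫⁻ x, ‖fderiv ℝ (w s) x‖ₑ ^ 2 ≤ ENNReal.ofReal (K / Real.sqrt (-s))) → (∀ t < 0, ∃ x ∈ Metric.ball (0 : EuclideanSpace ℝ (Fin 3)) (R * Real.sqrt (-t)), δ < ‖Real.sqrt (-t) • ((-t) • deriv (fun τ => w τ x) t - (1 / 2 : ℝ) • w t x - (1 / 2 :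 ℝ) • fderiv ℝ (w t) x x)‖) → (∀ t < 0, ∀ g : EuclideanSpace ℝ (Fin 3) ≃ₗᵢ[ℝ] EuclideanSpace ℝ (Fin 3), ∃ θ : ℝ, ∃ x ∈ Metric.ball (0 : EuclideanSpace ℝ (Fin 3)) (R' * Real.sqrt (-t)), δ' < Real.sqrt (-t) * ‖w t (g (Literature.Analysis.FluidPDE.rotZ θ (g.symm x))) - g (Literature.Analysis.FluidPDE.rotZ θ (g.symm (w t x)))‖) → ¬ (∀ r > 0, ∀ M : ℝ, ∃ t ∈ Set.Ioo (-(r ^ 2)) (0 : ℝ), ∃ x ∈ Metric.ball (0 : EuclideanSpace ℝ (Fin 3)) r, M < ‖w t x‖)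

-- parent: PerpetualFlickerLiouville · glue (gen 1)
/--     item stmt-NavierStokesRegularity-24454 · support · rank 203 · closed · proved by Summit.NavierStokesRegularity.NavierStokesRegularity.Theorems.calmSliceGate_perpetualFlickerLiouvilleGlue_proof (prover)
    parent: PerpetualFlickerLiouville · GLUE: children ⟹ parent · by planner
pure logic: either some slice of w is delta'-almost axisymmetric about an axis through the apex on
B(0,R' sqrt(-t)) (then OneSymmetricSlice) or every slice is delta'-far from every such symmetry
(then AsymmetricFlickerLiouville); 5-line proof in planner folder line2/Split.lean
(perpetualFlickerLiouville_of_symmetric_split: obtain delta' R' from OneSymmetricSlice C K; em; push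
Not) -/
@[route_item "route-NavierStokesRegularity-CalmSliceGate"]
def PerpetualFlickerLiouvilleGlue : Prop :=
  OneSymmetricSlice → AsymmetricFlickerLiouville → PerpetualFlickerLiouville

-- `PerpetualFlickerLiouvilleGlue` holds: proved by `Summit.NavierStokesRegularity.NavierStokesRegularity.Theorems.calmSliceGate_perpetualFlickerLiouvilleGlue_proof` (its module imports this route file, so no `_holds` link can be stated here).

/-- item stmt-NavierStokesRegularity-24375 · crux · rank 3 · closed · proved by Summit.NavierStokesRegularity.NavierStokesRegularity.Theorems.oneCalmSlice_proof (prover) · by planner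
why it might fail: interface risks: classical/pressure packaging of IsTypeIAncientMild for IsLerayProfile (any C1 pressure accepted — checked), forward uniqueness of bounded Oseen-mild solutions from one slice; singularity persistence needs the dissipation law (stated inside D).
sources: PineauVicol2026, Tsai1998, KochNadirashviliSereginSverak2009, ChaeKangLee2009
[crux] ONE CALM SLICE. For all C, K there are δ > 0 and R > 0 such that every Type-I ancient mild
solution w (constant C) with the finite-dissipation law (constant K) that has ONE slice t < 0 on
which 𝔘(t,x) ≤ δ for all ‖x‖ < R√(−t) is bounded on some backward parabolic cylinder at the origin.
Proof plan: contradiction sequence, rescale the calm slice to t = −1 (class, law and singularity are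
scale-invariant), KNSS compactness + persistent_singularity_seq + law_of_seqLimit, limit slice at −1
is an L⁶ (memLp_six_slice) C² solution of Leray's profile system (a = 1/2, ν = 1, mild pressure) ⇒
zero by tsai_selfsimilar_holds (q = 6) ⇒ limit zero on (−1,0) by forward uniqueness of mild
solutions ⇒ not singular. [difficulty: L] -/
@[route_item "route-NavierStokesRegularity-CalmSliceGate", crux]
def OneCalmSlice : Prop :=
  ∀ (C K : ℝ), ∃ δ > 0, ∃ R > 0, ∀ (w : ℝ → EuclideanSpace ℝ (Fin 3) → EuclideanSpace ℝ (Fin 3)), Literature.Analysis.FluidPDE.IsTypeIAncientMild C w → (∀ s : ℝ, s < 0 → ∫⁻ x, ‖fderiv ℝ (w s) x‖ₑ ^ 2 ≤ ENNReal.ofReal (K / Real.sqrt (-s))) → (∃ t < 0, ∀ x ∈ Metric.ball (0 : EuclideanSpace ℝ (Fin 3)) (R * Real.sqrt (-t)), ‖Real.sqrt (-t) • ((-t) • deriv (fun τ => w τ x) t - (1 / 2 : ℝ) • w t x - (1 / 2 : ℝ) • fderiv ℝ (w t) x x)‖ ≤ δ) → ¬ (∀ r > 0, ∀ M : ℝ,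 ∃ t ∈ Set.Ioo (-(r ^ 2)) (0 : ℝ), ∃ x ∈ Metric.ball (0 : EuclideanSpace ℝ (Fin 3)) r, M < ‖w t x‖)

-- `OneCalmSlice` holds: proved by `Summit.NavierStokesRegularity.NavierStokesRegularity.Theorems.oneCalmSlice_proof` (its module imports this route file, so no `_holds` link can be stated here).

/-- item stmt-NavierStokesRegularity-1574 · crux · rank 4 · open · by planner
why it might fail: Type-II blow-up (enstrophy growing faster than Leray's quarter rate along a sequence) is not excluded by any known mechanism; shared summit-live residual of LQD/QLP/CalmSliceGate.
sources: Leray1934, BradshawTsai2017CPDE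
[crux] QUARTER LAW / enstrophy at Leray's rate (card F6; absorbs leray-quanta-energy-modulus X_H).
If a finite-energy classical solution from a rapidly decaying datum is maximal at T<oo, then
Omega(t) = int |curl u(t)|^2 <= K (T-t)^{-1/2} on [0,T) for some K (lintegral form: infinite
enstrophy violates it). Leray1934 sec.19-22 gives the matching LOWER bound Omega >= c
nu^{3/2}(T-t)^{-1/2} (in tree: leray_blowup_rate_top family), so the claim is 'dissipation blows up
at exactly Leray's rate'. Spectral form (the card's thesis object): with alpha = xi.(grad u)xi and
Lambda(t) = sup_psi (int alpha_+|psi|^2 - nu int|grad psi|^2)/int|psi|^2 = sup spec(nu Lap +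
alpha_+), one has d/dt log Omega <= 2 Lambda, blow-up forces int_{t0}^t Lambda >= (1/4) log(1/(T-t))
- C, and the crux is equivalent to int_{t0}^t (Lambda_eff - 1/(4(T-s))) ds = O(1) with Lambda_eff :=
(1/2) d/dt log Omega <= Lambda: 'Type II <=> the stretching well binds more than a quarter per unit
log-time'. Consequences (not filed): E(Q(z,r)) = r^{-1} intint_Q |grad u|^2 <= 2K/nu-scaled for
EVERY parabolic ball below T (uniform rescaled-energy Type I => TypeIBridge); expected, to be
checked (leray-quanta graft): finitely many s -/
@[route_item "route-NavierStokesRegularity-CalmSliceGate", crux]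
def EnstrophyQuarterLaw : Prop :=
  ∀ (ν T : ℝ), 0 < ν → 0 < T → ∀ (u : ℝ → EuclideanSpace ℝ (Fin 3) → EuclideanSpace ℝ (Fin 3)) (p : ℝ → EuclideanSpace ℝ (Fin 3) → ℝ), Literature.Analysis.FluidPDE.IsMaximalSmoothSolution ν 0 u p T → Literature.Analysis.FluidPDE.IsLerayHopfOn T ν 0 (u 0) u → Literature.Analysis.FluidPDE.HasRapidSpatialDecay (u 0) → ∃ K : ℝ, ∀ t ∈ Set.Ico 0 T, ∫⁻ x, ‖Literature.Analysis.FluidPDE.curl (u t) x‖ₑ ^ 2 ≤ ENNReal.ofReal (K / Real.sqrt (T - t))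

/-- item stmt-NavierStokesRegularity-24376 · support · rank 9 · closed · proved by Summit.NavierStokesRegularity.NavierStokesRegularity.Theorems.calmSliceGate_recordTimeTypeI_proof (prover) · by planner
sources: KochNadirashviliSereginSverak2009
[support] LQD's record-time capacity lemma (stmt-NavierStokesRegularity-22145, CLOSED·proved):
enstrophy at the quarter rate forces velocity Type I. Restated verbatim so the deciding theorem can
call LQD's proved assembly. [difficulty: provable-now] -/
@[route_item "route-NavierStokesRegularity-CalmSliceGate", crux]
def RecordTimeTypeI : Prop :=
  ∀ (ν T : ℝ), 0 < ν → 0 < T → ∀ (u : ℝ → EuclideanSpace ℝ (Fin 3) → EuclideanSpace ℝ (Fin 3)) (p : ℝ → EuclideanSpace ℝ (Fin 3) → ℝ), Literature.Analysis.FluidPDE.IsClassicalNSSolutionOn (Set.Ico 0 T) ν 0 u p → Literature.Analysis.FluidPDE.IsLerayHopfOn T ν 0 (u 0) u → Literature.Analysis.FluidPDE.HasRapidSpatialDecay (u 0) → ∀ K : ℝ, (∀ t ∈ Set.Ico 0 T, ∫⁻ x, ‖Literature.Analysis.FluidPDE.curl (u t) x‖ₑ ^ 2 ≤ ENNReal.ofReal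 (K / Real.sqrt (T - t))) → Literature.Analysis.FluidPDE.IsTypeIBlowup u T

-- `RecordTimeTypeI` holds: proved by `Summit.NavierStokesRegularity.NavierStokesRegularity.Theorems.calmSliceGate_recordTimeTypeI_proof` (its module imports this route file, so no `_holds` link can be stated here).

/-- item stmt-NavierStokesRegularity-24377 · support · rank 9 · closed · proved by Summit.NavierStokesRegularity.NavierStokesRegularity.Theorems.calmSliceGate_dissipativeZoom_proof (prover) · by planner
sources: KochNadirashviliSereginSverak2009, AlbrittonBarker2019ARMA
[support] LQD's dissipative zoom (stmt-NavierStokesRegularity-22146, CLOSED·proved): at a singular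
point of a Type-I blow-up with the quarter law, the KNSS zoom yields a Type-I ancient mild profile
with the finite-dissipation law, singular at the apex. Restated verbatim. [difficulty: provable-now] -/
@[route_item "route-NavierStokesRegularity-CalmSliceGate", crux]
def DissipativeZoom : Prop :=
  ∀ (ν T : ℝ), 0 < ν → 0 < T → ∀ (u : ℝ → EuclideanSpace ℝ (Fin 3) → EuclideanSpace ℝ (Fin 3)) (p : ℝ → EuclideanSpace ℝ (Fin 3) → ℝ), Literature.Analysis.FluidPDE.IsClassicalNSSolutionOn (Set.Ico 0 T) ν 0 u p → Literature.Analysis.FluidPDE.IsLerayHopfOn T ν 0 (u 0) u → Literature.Analysis.FluidPDE.HasRapidSpatialDecay (u 0) → Literature.Analysis.FluidPDE.IsTypeIBlowup u T → ∀ K : ℝ, (∀ t ∈ Set.Ico 0 T, ∫⁻ x, ‖Literature.Analysis.FluidPDE.curl (u t) x‖ₑ ^ 2 ≤ ENNReal.ofReal (K / Real.sqrt (T - t))) → ∀ x₀ : EuclideanSpace ℝ (Fin 3), (∀ r : ℝ, 0 < r → r ^ 2 < T → eLpNorm (Function.uncurry u) ⊤ (volume.restrict (Literature.Analysis.FluidPDE.parabolicCylinder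 r ((T : ℝ), x₀))) = ⊤) → ∃ (C K' : ℝ) (ū : ℝ → EuclideanSpace ℝ (Fin 3) → EuclideanSpace ℝ (Fin 3)), Literature.Analysis.FluidPDE.IsTypeIAncientMild C ū ∧ (∀ s : ℝ, s < 0 → ∫⁻ x, ‖fderiv ℝ (ū s) x‖ₑ ^ 2 ≤ ENNReal.ofReal (K' / Real.sqrt (-s))) ∧ (∀ r > 0, ∀ M : ℝ, ∃ t ∈ Set.Ioo (-(r ^ 2)) (0 : ℝ), ∃ x ∈ Metric.ball (0 : EuclideanSpace ℝ (Fin 3)) r, M < ‖ū t x‖)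

-- `DissipativeZoom` holds: proved by `Summit.NavierStokesRegularity.NavierStokesRegularity.Theorems.calmSliceGate_dissipativeZoom_proof` (its module imports this route file, so no `_holds` link can be stated here).

/-- item stmt-NavierStokesRegularity-24378 · assembly · rank 1 · closed · proved by Summit.NavierStokesRegularity.NavierStokesRegularity.Theorems.calmSliceGate_assembly_proof (prover) · by planner
sources: KochNadirashviliSereginSverak2009, PineauVicol2026
[assembly] EQL → RecordTimeTypeI → DissipativeZoom → OneCalmSlice → PerpetualFlickerLiouville →
NavierStokesRegularity (the deciding theorem closes, via LQD's proved assembly and the calm/flicker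
case split). -/
@[route_item "route-NavierStokesRegularity-CalmSliceGate"]
def Assembly : Prop :=
  EnstrophyQuarterLaw → RecordTimeTypeI → DissipativeZoom → OneCalmSlice → PerpetualFlickerLiouville → NavierStokesRegularity

-- `Assembly` holds: proved by `Summit.NavierStokesRegularity.NavierStokesRegularity.Theorems.calmSliceGate_assembly_proof` (its module imports this route file, so no `_holds` link can be stated here).

/-! D-0027 §2.1 — DECIDING THEOREM (planner-authored via `route open/edit --closes-file`; by planner-ns-idea-3-g3-0 2026-08-28T01:21:00Z):
its hypotheses are this route's items and its conclusion the sub-problem Statement (glue_lint), and it elaborates with this file. -/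

@[closes "route-NavierStokesRegularity-CalmSliceGate"] theorem closes (hQ : EnstrophyQuarterLaw) (hR : RecordTimeTypeI) (hZ : DissipativeZoom) (hCalm : OneCalmSlice)
    (hFlick : PerpetualFlickerLiouville) : NavierStokesRegularity := by
  refine Summit.NavierStokesRegularity.NavierStokesRegularity.Theorems.lerayQuarterDissipation_assembly_proof hQ hR hZ ?_
  intro C K w hw hD
  obtain ⟨δ, hδ, R, hRpos, h1⟩ := hCalm C K
  refine (em _).elim (h1 w hw hD) (fun hc => ?_)
  push Not at hc
  exact hFlick C K δ R hδ hRpos w hw hD hc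

end Summit.NavierStokesRegularity.NavierStokesRegularity.Theses.CalmSliceGate
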